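import Summits.NavierStokesRegularity.NavierStokesRegularity.Theorems.ExtremiserTransienceNearExtremalTransienceExtremiserLiouvilleConstantSpeedSlideGenerator
import HarnessLib

/-!
# Crux `ExtremiserTransience.NearExtremalTransience` (stmt-NavierStokesRegularity-21883), line `extremiser_liouville`,
# stub K1b — LATERAL-FLUX CANCELLATION: the bare energy term of a horizontally truncated slide is a difference of lateral fluxes

`--supports stmt-NavierStokesRegularity-21883` (helper).  Author: prover seat `ns-el-k1b` (g8).  Record:
`Cruxes/NearExtremalTransience/Lines/extremiser_liouville_k1b_slide.md` §10 (F2) — the FLAT alternative.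

For the FLAT residue the slide must be truncated horizontally, `g(x) = g₁(x₂)χ(x_h)`, and the only term of its first variation
that could see the infinite slab energy is the bare pairing `∫g₁‴(x₂)χ‖V‖²`.  For a divergence-free `V` with the constant-speed
relation `⟪V, c⟫ = −‖V‖²/2`, `c = (0,0,c₂)` (so `‖V‖² = −2c₂V₂`, `∂₂‖V‖² = 2c₂ div_h V_h`) and an `x₂`-independent cut-off `χ`:
* `integral_thirdDeriv_cutoff_mul_sq_eq` : **`∫ g‴(x₂)χ(x)‖V(x)‖² dx = −2c₂ ∫ g′(x₂)·Dχ(x)(∂₂V(x)) dx`** — two applications of the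
  divergence theorem to the compactly supported fields `(g″χ)V` and `(g′·Dχ(V))e₂`; NO slab integrability is used;
* `abs_integral_thirdDeriv_cutoff_mul_sq_le` : hence `|∫g‴χ‖V‖²| ≤ 2|c₂|·‖g′‖_∞ ∫ ‖Dχ‖·‖∂₂V‖` over the support of `Dχ` — with
  `χ = χ₁(·/R)` this is `O(R⁻¹·R·√H)·‖∂₂V‖_{L²(annulus)} → 0`: the lateral volume fluxes through the cut-off at the two ends of the
  layer are individually unbounded for a flat residue, but their difference is controlled by `∂₂V ∈ L²`.

WHAT THIS IS NOT: K1b is NOT proved; nothing here proves NS regularity. [folklore]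
-/

noncomputable section

open Set Filter Topology MeasureTheory Metric Function InnerProductSpace
open scoped ENNReal NNReal Topology InnerProductSpace RealInnerProductSpace ContDiff
open Literature.Analysis.FluidPDE Literature.Analysis

namespace Summit.NavierStokesRegularity.NavierStokesRegularity.Theorems

-- the problem directory repeats the summit name (`NavierStokesRegularity/NavierStokesRegularity`)
set_option linter.dupNamespace false

namespace ExtremiserLiouville

open DepletionLadder.KStar

variable {V : EuclideanSpace ℝ (Fin 3) → EuclideanSpace ℝ (Fin 3)} {c : EuclideanSpace ℝ (Fin 3)} {g : ℝ → ℝ}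
  {χ : EuclideanSpace ℝ (Fin 3) → ℝ}

/-- Compact support in the box: a function vanishing for `T ≤ |x₂|` and for `ρ ≤ ‖x − x₂e₂‖` vanishes outside the closed ball of
radius `|T| + |ρ|`. [folklore] -/
theorem hasCompactSupport_of_box {F : Type*} [Zero F] {f : EuclideanSpace ℝ (Fin 3) → F} {T ρ : ℝ}
    (hT : ∀ x : EuclideanSpace ℝ (Fin 3), T ≤ |x 2| → f x = 0)
    (hρ : ∀ x : EuclideanSpace ℝ (Fin 3), ρ ≤ ‖x - (x 2) • EuclideanSpace.single (2 : Fin 3) (1 : ℝ)‖ → f x = 0) :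
    HasCompactSupport f := by
  refine HasCompactSupport.intro (isCompact_closedBall (0 : EuclideanSpace ℝ (Fin 3)) (|T| + |ρ|)) fun x hx => ?_
  rw [mem_closedBall, dist_zero_right, not_le] at hx
  by_contra hne
  have h1 : |x 2| < T := by by_contra h; exact hne (hT x (not_lt.1 h))
  have h2 : ‖x - (x 2) • EuclideanSpace.single (2 : Fin 3) (1 : ℝ)‖ < ρ := by by_contra h; exact hne (hρ x (not_lt.1 h))
  have h3 : ‖x‖ ≤ ‖x - (x 2) • EuclideanSpace.single (2 : Fin 3) (1 : ℝ)‖ + ‖(x 2) • EuclideanSpace.single (2 : Fin 3) (1 : ℝ)‖ := by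
    have := norm_add_le (x - (x 2) • EuclideanSpace.single (2 : Fin 3) (1 : ℝ)) ((x 2) • EuclideanSpace.single (2 : Fin 3) (1 : ℝ))
    rwa [sub_add_cancel] at this
  have h4 : ‖(x 2) • EuclideanSpace.single (2 : Fin 3) (1 : ℝ)‖ = |x 2| := by
    rw [norm_smul, PiLp.norm_single, norm_one, mul_one, Real.norm_eq_abs]
  have : T ≤ |T| := le_abs_self T
  have : ρ ≤ |ρ| := le_abs_self ρ
  linarith

/-- **Lateral-flux cancellation.**  For `V ∈ C¹` divergence free with `⟪V, c⟫ = −‖V‖²/2`, `c = (0,0,c₂)`, an `x₂`-independent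
cut-off `χ ∈ C²` (`∂₂χ ≡ 0`) vanishing together with `Dχ` for `ρ ≤ ‖x − x₂e₂‖`, and `g ∈ C³` with `g′, g″, g‴` vanishing for
`T ≤ |s|`:  `∫ g‴(x₂)χ(x)‖V(x)‖²dx = −2c₂∫ g′(x₂)·Dχ(x)(∂₂V(x))dx`. [folklore] -/
theorem integral_thirdDeriv_cutoff_mul_sq_eq (hV : ContDiff ℝ 1 V) (hdiv : VectorCalculus.IsDivFree V)
    (hVc : ∀ x, ⟪V x, c⟫ = -(‖V x‖ ^ 2 / 2)) (hc0 : c 0 = 0) (hc1 : c 1 = 0)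
    (hχ : ContDiff ℝ 2 χ) (hχ2 : ∀ x, fderiv ℝ χ x (EuclideanSpace.single (2 : Fin 3) (1 : ℝ)) = 0)
    {ρ T : ℝ} (hχρ : ∀ x, ρ ≤ ‖x - (x 2) • EuclideanSpace.single (2 : Fin 3) (1 : ℝ)‖ → χ x = 0)
    (hχρ' : ∀ x, ρ ≤ ‖x - (x 2) • EuclideanSpace.single (2 : Fin 3) (1 : ℝ)‖ → fderiv ℝ χ x = 0)
    (hg : ContDiff ℝ 3 g) (hg1T : ∀ s, T ≤ |s| → deriv g s = 0) (hg2T : ∀ s, T ≤ |s| → deriv (deriv g) s = 0)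
    (hg3T : ∀ s, T ≤ |s| → deriv (deriv (deriv g)) s = 0) :
    (∫ x, deriv (deriv (deriv g)) (x 2) * χ x * ‖V x‖ ^ 2) =
      -2 * c 2 * ∫ x, deriv g (x 2) * fderiv ℝ χ x (fderiv ℝ V x (EuclideanSpace.single (2 : Fin 3) (1 : ℝ))) := by
  set e₂ : EuclideanSpace ℝ (Fin 3) := EuclideanSpace.single (2 : Fin 3) (1 : ℝ) with he₂
  have hVd : Differentiable ℝ V := hV.differentiable one_ne_zero
  have hχd : Differentiable ℝ χ := hχ.differentiable two_ne_zero
  have hχ1 : ContDiff ℝ 1 χ := hχ.of_le (by norm_num)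
  have hg2 : ContDiff ℝ 2 (deriv g) := by
    have h3 : ContDiff ℝ (2 + 1) g := by rw [show ((2 : WithTop ℕ∞) + 1) = 3 by norm_num]; exact hg
    exact h3.deriv'
  have hg1 : ContDiff ℝ 1 (deriv (deriv g)) := by
    have h2 : ContDiff ℝ (1 + 1) (deriv g) := by rw [show ((1 : WithTop ℕ∞) + 1) = 2 by norm_num]; exact hg2
    exact h2.deriv'
  have hg2d : Differentiable ℝ (deriv (deriv g)) := hg1.differentiable one_ne_zero
  have hg1d : Differentiable ℝ (deriv g) := hg2.differentiable two_ne_zero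
  -- `V₂ = −‖V‖²/(2c₂)`: `‖V‖² = −2 c₂ V₂`
  have hsq : ∀ x, ‖V x‖ ^ 2 = -2 * c 2 * V x 2 := fun x => by
    have h := hVc x
    have hinner : ⟪V x, c⟫ = V x 2 * c 2 := by
      simp only [PiLp.inner_apply, RCLike.inner_apply, conj_trivial, Fin.sum_univ_three, hc0, hc1]; ring
    rw [hinner] at h
    linarith
  -- axial profiles as functions on `ℝ³`
  set a2 : EuclideanSpace ℝ (Fin 3) → ℝ := fun y => deriv (deriv g) (y 2) with ha2
  set a1 : EuclideanSpace ℝ (Fin 3) → ℝ := fun y => deriv g (y 2) with ha1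
  have ha2D : ∀ y, HasFDerivAt a2 (deriv (deriv (deriv g)) (y 2) •
      (EuclideanSpace.proj (2 : Fin 3) : EuclideanSpace ℝ (Fin 3) →L[ℝ] ℝ)) y := fun y => hasFDerivAt_comp_coord hg2d 2 y
  have ha1D : ∀ y, HasFDerivAt a1 (deriv (deriv g) (y 2) •
      (EuclideanSpace.proj (2 : Fin 3) : EuclideanSpace ℝ (Fin 3) →L[ℝ] ℝ)) y := fun y => hasFDerivAt_comp_coord hg1d 2 y
  have ha2c : ContDiff ℝ 1 a2 := by
    have : a2 = fun y => deriv (deriv g) ((EuclideanSpace.proj (2 : Fin 3) : EuclideanSpace ℝ (Fin 3) →L[ℝ] ℝ) y) := rfl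
    rw [this]; exact hg1.comp (EuclideanSpace.proj (2 : Fin 3) : EuclideanSpace ℝ (Fin 3) →L[ℝ] ℝ).contDiff
  have ha1c : ContDiff ℝ 1 a1 := by
    have : a1 = fun y => deriv g ((EuclideanSpace.proj (2 : Fin 3) : EuclideanSpace ℝ (Fin 3) →L[ℝ] ℝ) y) := rfl
    rw [this]; exact (hg2.of_le (by norm_num)).comp (EuclideanSpace.proj (2 : Fin 3) : EuclideanSpace ℝ (Fin 3) →L[ℝ] ℝ).contDiff
  have he2 : ∀ y : EuclideanSpace ℝ (Fin 3), (EuclideanSpace.proj (2 : Fin 3) : EuclideanSpace ℝ (Fin 3) →L[ℝ] ℝ) y = y 2 :=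
    fun y => rfl
  -- STEP 1: the field `Y = (g″χ) • V`
  have hY1 : ContDiff ℝ 1 fun y => (a2 y * χ y) • V y := (ha2c.mul hχ1).smul hV
  have hYc : HasCompactSupport fun y => (a2 y * χ y) • V y := by
    refine hasCompactSupport_of_box (T := T) (ρ := ρ) (fun x hx => ?_) (fun x hx => ?_)
    · simp only [ha2, hg2T _ hx, zero_mul, zero_smul]
    · simp only [hχρ x hx, mul_zero, zero_smul]
  have hdivY : ∀ x, VectorCalculus.divergence (fun y => (a2 y * χ y) • V y) x =
      deriv (deriv (deriv g)) (x 2) * χ x * V x 2 + deriv (deriv g) (x 2) * fderiv ℝ χ x (V x) := by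
    intro x
    rw [Literature.Analysis.FluidPDE.divergence_smul_apply (((ha2c.mul hχ1).differentiable one_ne_zero) x) (hVd x), hdiv x,
      mul_zero, zero_add, real_inner_comm, gradient, InnerProductSpace.toDual_symm_apply]
    have hm : HasFDerivAt (fun y => a2 y * χ y)
        (a2 x • fderiv ℝ χ x + χ x • (deriv (deriv (deriv g)) (x 2) •
          (EuclideanSpace.proj (2 : Fin 3) : EuclideanSpace ℝ (Fin 3) →L[ℝ] ℝ))) x := (ha2D x).mul (hχd x).hasFDerivAt
    rw [hm.fderiv]
    show a2 x * fderiv ℝ χ x (V x) + χ x * (deriv (deriv (deriv g)) (x 2) * V x 2) = _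
    simp only [ha2]; ring
  have h0 := integral_divergence_eq_zero hY1 hYc
  simp_rw [hdivY] at h0
  have cV : Continuous V := hV.continuous
  have cDχV : Continuous fun x => fderiv ℝ χ x (V x) := (hχ.continuous_fderiv two_ne_zero).clm_apply cV
  have cg3 : Continuous fun x : EuclideanSpace ℝ (Fin 3) => deriv (deriv (deriv g)) (x 2) :=
    (hg1.continuous_deriv le_rfl).comp (PiLp.continuous_apply 2 _ (2 : Fin 3))
  have cg2 : Continuous fun x : EuclideanSpace ℝ (Fin 3) => deriv (deriv g) (x 2) := hg2d.continuous.comp (PiLp.continuous_apply 2 _ (2 : Fin 3))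
  have cg1 : Continuous fun x : EuclideanSpace ℝ (Fin 3) => deriv g (x 2) := hg1d.continuous.comp (PiLp.continuous_apply 2 _ (2 : Fin 3))
  have i1 : Integrable (fun x => deriv (deriv (deriv g)) (x 2) * χ x * V x 2) volume := by
    have cf : Continuous fun x => deriv (deriv (deriv g)) (x 2) * χ x * V x 2 :=
      (cg3.mul hχ.continuous).mul ((PiLp.continuous_apply 2 _ (2 : Fin 3)).comp cV)
    refine cf.integrable_of_hasCompactSupport ?_
    refine hasCompactSupport_of_box (T := T) (ρ := ρ) (fun x hx => ?_) (fun x hx => ?_)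
    · show deriv (deriv (deriv g)) (x 2) * χ x * V x 2 = 0
      rw [hg3T _ hx, zero_mul, zero_mul]
    · show deriv (deriv (deriv g)) (x 2) * χ x * V x 2 = 0
      rw [hχρ x hx, mul_zero, zero_mul]
  have i2 : Integrable (fun x => deriv (deriv g) (x 2) * fderiv ℝ χ x (V x)) volume := by
    have cf : Continuous fun x => deriv (deriv g) (x 2) * fderiv ℝ χ x (V x) := cg2.mul cDχV
    refine cf.integrable_of_hasCompactSupport ?_
    refine hasCompactSupport_of_box (T := T) (ρ := ρ) (fun x hx => ?_) (fun x hx => ?_)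
    · show deriv (deriv g) (x 2) * fderiv ℝ χ x (V x) = 0
      rw [hg2T _ hx, zero_mul]
    · show deriv (deriv g) (x 2) * fderiv ℝ χ x (V x) = 0
      rw [hχρ' x hx]; simp
  rw [integral_add i1 i2] at h0
  -- STEP 2: the field `Z = (g′·Dχ(V)) • e₂`
  have hDχ : ∀ x, HasFDerivAt (fderiv ℝ χ) (fderiv ℝ (fderiv ℝ χ) x) x := fun x =>
    (((hχ.fderiv_right (m := 1) (by norm_num)).differentiable one_ne_zero) x).hasFDerivAt
  have hq : ∀ x, HasFDerivAt (fun y => fderiv ℝ χ y (V y))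
      ((fderiv ℝ χ x).comp (fderiv ℝ V x) + (fderiv ℝ (fderiv ℝ χ) x).flip (V x)) x := fun x =>
    (hDχ x).clm_apply (hVd x).hasFDerivAt
  have hq2 : ContDiff ℝ 1 fun y => fderiv ℝ χ y (V y) := (hχ.fderiv_right (m := 1) (by norm_num)).clm_apply hV
  -- `D²χ(x)(e₂, ·) = 0`
  have hD2χ : ∀ x (u : EuclideanSpace ℝ (Fin 3)), fderiv ℝ (fderiv ℝ χ) x u e₂ = 0 := by
    intro x u
    have hd : DifferentiableAt ℝ (fderiv ℝ χ) x := (hDχ x).differentiableAt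
    have h1 : fderiv ℝ (fderiv ℝ χ) x u e₂ = fderiv ℝ (fun y => fderiv ℝ χ y e₂) x u := by
      rw [fderiv_clm_apply hd (differentiableAt_const e₂)]
      simp only [fderiv_fun_const, Pi.zero_apply, ContinuousLinearMap.comp_zero, zero_add,
        ContinuousLinearMap.flip_apply]
    rw [h1]
    have hz : (fun y => fderiv ℝ χ y e₂) = fun _ => (0 : ℝ) := funext fun y => hχ2 y
    rw [hz, fderiv_fun_const, Pi.zero_apply]; simp
  have hZ1 : ContDiff ℝ 1 fun y => (a1 y * fderiv ℝ χ y (V y)) • e₂ := (ha1c.mul hq2).smul contDiff_const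
  have hZc : HasCompactSupport fun y => (a1 y * fderiv ℝ χ y (V y)) • e₂ := by
    refine hasCompactSupport_of_box (T := T) (ρ := ρ) (fun x hx => ?_) (fun x hx => ?_)
    · simp only [ha1, hg1T _ hx, zero_mul, zero_smul]
    · rw [hχρ' x hx]; simp
  have hdivZ : ∀ x, VectorCalculus.divergence (fun y => (a1 y * fderiv ℝ χ y (V y)) • e₂) x =
      deriv (deriv g) (x 2) * fderiv ℝ χ x (V x) + deriv g (x 2) * fderiv ℝ χ x (fderiv ℝ V x e₂) := by
    intro x
    rw [Literature.Analysis.FluidPDE.divergence_smul_apply (((ha1c.mul hq2).differentiable one_ne_zero) x)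
      (differentiableAt_const e₂)]
    have hdivconst : VectorCalculus.divergence (fun _ : EuclideanSpace ℝ (Fin 3) => e₂) x = 0 := by
      rw [divergence_eq_sum_three]; simp
    rw [hdivconst, mul_zero, zero_add, real_inner_comm, gradient, InnerProductSpace.toDual_symm_apply]
    have hm : HasFDerivAt (fun y => a1 y * fderiv ℝ χ y (V y))
        (a1 x • ((fderiv ℝ χ x).comp (fderiv ℝ V x) + (fderiv ℝ (fderiv ℝ χ) x).flip (V x)) +
          fderiv ℝ χ x (V x) • (deriv (deriv g) (x 2) • (EuclideanSpace.proj (2 : Fin 3) : EuclideanSpace ℝ (Fin 3) →L[ℝ] ℝ))) x :=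
      (ha1D x).mul (hq x)
    rw [hm.fderiv]
    show a1 x * (fderiv ℝ χ x (fderiv ℝ V x e₂) + fderiv ℝ (fderiv ℝ χ) x e₂ (V x)) +
        fderiv ℝ χ x (V x) * (deriv (deriv g) (x 2) * e₂ 2) = _
    have hsymm : fderiv ℝ (fderiv ℝ χ) x e₂ (V x) = fderiv ℝ (fderiv ℝ χ) x (V x) e₂ :=
      (hχ.contDiffAt.isSymmSndFDerivAt (by simp)) e₂ (V x)
    have e2 : e₂ 2 = 1 := by rw [he₂]; simp
    rw [hsymm, hD2χ, add_zero, e2, mul_one]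
    simp only [ha1]; ring
  have h0' := integral_divergence_eq_zero hZ1 hZc
  simp_rw [hdivZ] at h0'
  have i3 : Integrable (fun x => deriv g (x 2) * fderiv ℝ χ x (fderiv ℝ V x e₂)) volume := by
    have cf : Continuous fun x => deriv g (x 2) * fderiv ℝ χ x (fderiv ℝ V x e₂) :=
      cg1.mul ((hχ.continuous_fderiv two_ne_zero).clm_apply ((hV.continuous_fderiv one_ne_zero).clm_apply continuous_const))
    refine cf.integrable_of_hasCompactSupport ?_
    refine hasCompactSupport_of_box (T := T) (ρ := ρ) (fun x hx => ?_) (fun x hx => ?_)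
    · show deriv g (x 2) * fderiv ℝ χ x (fderiv ℝ V x e₂) = 0
      rw [hg1T _ hx, zero_mul]
    · show deriv g (x 2) * fderiv ℝ χ x (fderiv ℝ V x e₂) = 0
      rw [hχρ' x hx]; simp
  rw [integral_add i2 i3] at h0'
  -- assemble: `∫g‴χ‖V‖² = −2c₂∫g‴χV₂ = 2c₂∫g″Dχ(V) = −2c₂∫g′Dχ(∂₂V)`
  have e1 : (∫ x, deriv (deriv (deriv g)) (x 2) * χ x * ‖V x‖ ^ 2) =
      -2 * c 2 * ∫ x, deriv (deriv (deriv g)) (x 2) * χ x * V x 2 := by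
    rw [← integral_const_mul]
    refine integral_congr_ae (Eventually.of_forall fun x => ?_)
    dsimp only
    rw [hsq]; ring
  rw [e1]
  have e2' : (∫ x, deriv (deriv (deriv g)) (x 2) * χ x * V x 2) = -∫ x, deriv (deriv g) (x 2) * fderiv ℝ χ x (V x) := by
    linarith
  have e3 : (∫ x, deriv (deriv g) (x 2) * fderiv ℝ χ x (V x)) = -∫ x, deriv g (x 2) * fderiv ℝ χ x (fderiv ℝ V x e₂) := by
    linarith
  rw [e2', e3]
  ring

/-- **The bound**: `|∫g‴χ‖V‖²| ≤ 2|c₂|·K·∫‖Dχ‖‖∂₂V‖` when `|g′| ≤ K` (same hypotheses). [folklore] -/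
theorem abs_integral_thirdDeriv_cutoff_mul_sq_le (hV : ContDiff ℝ 1 V) (hdiv : VectorCalculus.IsDivFree V)
    (hVc : ∀ x, ⟪V x, c⟫ = -(‖V x‖ ^ 2 / 2)) (hc0 : c 0 = 0) (hc1 : c 1 = 0)
    (hχ : ContDiff ℝ 2 χ) (hχ2 : ∀ x, fderiv ℝ χ x (EuclideanSpace.single (2 : Fin 3) (1 : ℝ)) = 0)
    {ρ T K : ℝ} (hχρ : ∀ x, ρ ≤ ‖x - (x 2) • EuclideanSpace.single (2 : Fin 3) (1 : ℝ)‖ → χ x = 0)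
    (hχρ' : ∀ x, ρ ≤ ‖x - (x 2) • EuclideanSpace.single (2 : Fin 3) (1 : ℝ)‖ → fderiv ℝ χ x = 0)
    (hg : ContDiff ℝ 3 g) (hgK : ∀ s, |deriv g s| ≤ K) (hg1T : ∀ s, T ≤ |s| → deriv g s = 0)
    (hg2T : ∀ s, T ≤ |s| → deriv (deriv g) s = 0) (hg3T : ∀ s, T ≤ |s| → deriv (deriv (deriv g)) s = 0)
    (hi : Integrable (fun x => {x : EuclideanSpace ℝ (Fin 3) | |x 2| < T}.indicator
      (fun x => ‖fderiv ℝ χ x‖ * ‖fderiv ℝ V x (EuclideanSpace.single (2 : Fin 3) (1 : ℝ))‖) x) volume) :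
    |∫ x, deriv (deriv (deriv g)) (x 2) * χ x * ‖V x‖ ^ 2| ≤
      2 * |c 2| * K * ∫ x, {x : EuclideanSpace ℝ (Fin 3) | |x 2| < T}.indicator
        (fun x => ‖fderiv ℝ χ x‖ * ‖fderiv ℝ V x (EuclideanSpace.single (2 : Fin 3) (1 : ℝ))‖) x := by
  rw [integral_thirdDeriv_cutoff_mul_sq_eq hV hdiv hVc hc0 hc1 hχ hχ2 hχρ hχρ' hg hg1T hg2T hg3T, abs_mul, abs_mul, abs_neg,
    abs_two]
  have hK0 : 0 ≤ K := (abs_nonneg _).trans (hgK 0)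
  have hb : |∫ x, deriv g (x 2) * fderiv ℝ χ x (fderiv ℝ V x (EuclideanSpace.single (2 : Fin 3) (1 : ℝ)))| ≤
      K * ∫ x, {x : EuclideanSpace ℝ (Fin 3) | |x 2| < T}.indicator
        (fun x => ‖fderiv ℝ χ x‖ * ‖fderiv ℝ V x (EuclideanSpace.single (2 : Fin 3) (1 : ℝ))‖) x := by
    rw [← integral_const_mul]
    refine (abs_integral_le_integral_abs).trans (integral_mono_of_nonneg (Eventually.of_forall fun x => abs_nonneg _)
      (hi.const_mul K) (Eventually.of_forall fun x => ?_))
    dsimp only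
    by_cases hx : |x 2| < T
    · rw [indicator_of_mem (show x ∈ {x : EuclideanSpace ℝ (Fin 3) | |x 2| < T} from hx), abs_mul]
      calc |deriv g (x 2)| * |fderiv ℝ χ x (fderiv ℝ V x (EuclideanSpace.single (2 : Fin 3) (1 : ℝ)))|
          ≤ K * (‖fderiv ℝ χ x‖ * ‖fderiv ℝ V x (EuclideanSpace.single (2 : Fin 3) (1 : ℝ))‖) :=
            mul_le_mul (hgK _) (by rw [← Real.norm_eq_abs]; exact (fderiv ℝ χ x).le_opNorm _) (abs_nonneg _) hK0
        _ = K * (‖fderiv ℝ χ x‖ * ‖fderiv ℝ V x (EuclideanSpace.single (2 : Fin 3) (1 : ℝ))‖) := rfl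
    · rw [hg1T _ (not_lt.1 hx), zero_mul, abs_zero]
      exact mul_nonneg hK0 (indicator_nonneg (fun _ _ => mul_nonneg (norm_nonneg _) (norm_nonneg _)) _)
  have h2c : 0 ≤ 2 * |c 2| := by positivity
  calc 2 * |c 2| * |∫ x, deriv g (x 2) * fderiv ℝ χ x (fderiv ℝ V x (EuclideanSpace.single (2 : Fin 3) (1 : ℝ)))|
      ≤ 2 * |c 2| * (K * ∫ x, {x : EuclideanSpace ℝ (Fin 3) | |x 2| < T}.indicator
          (fun x => ‖fderiv ℝ χ x‖ * ‖fderiv ℝ V x (EuclideanSpace.single (2 : Fin 3) (1 : ℝ))‖) x) :=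
        mul_le_mul_of_nonneg_left hb h2c
    _ = _ := by ring

end ExtremiserLiouville

end Summit.NavierStokesRegularity.NavierStokesRegularity.Theorems

end
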